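import Summits.ValiantsHypothesis.ValiantsHypothesis.Theorems.LacunarySymmetroidMatrixDescartesCensusReflectGauss
import Summits.ValiantsHypothesis.ValiantsHypothesis.Theorems.LacunarySymmetroidMatrixDescartesFiniteSectorRealisableSevenThree

/-!
# `MatrixDescartes` — line «finite»: `FullyRealisable m d n` BY REFLECTION (one kernel computation per witness)

HONEST FRAMING.  Object-search cell `pub-symmetroid`, seat val-sym-eng-3 g8 (census/instrument engine #3).  HELPER of
the crux item `stmt-ValiantsHypothesis-18050` with NO closure claim: verification infrastructure only.  It glues two
existing kernel tools: the REFLECTIVE certificate check `Census.Reflect.certCheckG` of val-v1x-eng-8 and eng-10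
(`…CensusReflectGauss`: all letters symmetric, `n + 1` positive rational points strictly increasing, consecutive
exact determinant signs — computed by fraction-free Gaussian elimination in `ℤ` — multiply to `−1`; ONE `decide +kernel`)
and the seat's certificate adapter `fullyRealisable_of_certificate` (p605516) with the potential (row/column degree
budget) bound `natDegree_det_le_of_potentials` (p646649).  Result: `fullyRealisable_of_certCheckG` — an INTEGER witness
`S : Fin K → Fin m → Fin m → ℤ`, points `a j / b j`, and potentials `r, c` with `Σ r + Σ c = n` dominating the support
degrees give `FullyRealisable m d n` from `certCheckG … = true`; so a stamp-realisation certificate of ANY size is ONE short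
file (the `(9,3)`/`(10,3)` certificates of this seat needed 7 + 14 numeric sign files under the per-file farm rule).
[folklore] Descartes / intermediate value theorem bookkeeping + proof by reflection; nothing here bears on the crux or on
`VP ≠ VNP`.
-/

-- `Summit.ValiantsHypothesis.ValiantsHypothesis.…` repeats a component by the D-0017 layout
-- (single-conjunct summit), which the `dupNamespace` linter flags; the name is mandated.
set_option linter.dupNamespace false

namespace Summit.ValiantsHypothesis.ValiantsHypothesis.Theorems.LacunarySymmetroidMatrixDescartes.FiniteSector

open Summit.ValiantsHypothesis.ValiantsHypothesis.Theorems.LacunarySymmetroidMatrixDescartes.Census.Reflect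
  (certCheck certCheckG certCheckG_eq finAll finMax of_finAll le_finMax evalAt idet signAt det_evalAt realLetters_isSymm
   mul_neg_of_sign)
open Summit.ValiantsHypothesis.ValiantsHypothesis.Theorems.SymmetroidDescartes (eval_det_pencil)
open scoped BigOperators Matrix
open Polynomial

/-- **`FullyRealisable` by reflection.**  If the Gaussian reflective check `certCheckG m K n d S a b` of an integer letter
family `S` at `n + 1` rational points `a j / b j` evaluates to `true` (letters symmetric, points positive and increasing,
`n` sign alternations of `det`), and integer potentials `r, c : Fin m → ℕ` with `Σ r + Σ c = n` satisfy `d l ≤ r i + c j`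
whenever `S l i j ≠ 0` (so `natDegree det ≤ n`), then the real pencil of `S` witnesses `FullyRealisable m d n`
(degree exactly `n`, `n` distinct positive roots). [folklore] -/
theorem fullyRealisable_of_certCheckG {m K n : ℕ} {d : Fin K → ℕ} {S : Fin K → Fin m → Fin m → ℤ}
    {a b : Fin (n + 1) → ℕ} (h : certCheckG m K n d S a b = true)
    (r c : Fin m → ℕ) (hpot : ∀ l i j, S l i j ≠ 0 → d l ≤ r i + c j) (hsum : ∑ i, r i + ∑ j, c j = n) :
    FullyRealisable m d n := by
  rw [certCheckG_eq] at h
  simp only [certCheck, Bool.and_eq_true] at h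
  obtain ⟨hsymm, hpos, hmono, hsign⟩ := h
  have hS : ∀ l i j, S l i j = S l j i := fun l i j => by
    simpa using of_finAll (of_finAll (of_finAll hsymm l) i) j
  have ha : ∀ j, 0 < a j := fun j => by
    have := of_finAll hpos j; simp only [Bool.and_eq_true, decide_eq_true_eq] at this; exact this.1
  have hb : ∀ j, 0 < b j := fun j => by
    have := of_finAll hpos j; simp only [Bool.and_eq_true, decide_eq_true_eq] at this; exact this.2
  have hlt : ∀ i : Fin n, a i.castSucc * b i.succ < a i.succ * b i.castSucc := fun i => by
    simpa using of_finAll hmono i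
  have hsg : ∀ i : Fin n, signAt m K (finMax K d) d S (a i.castSucc) (b i.castSucc)
      * signAt m K (finMax K d) d S (a i.succ) (b i.succ) = -1 := fun i => by
    simpa using of_finAll hsign i
  -- the real pencil and its test points
  set SR : Fin K → Matrix (Fin m) (Fin m) ℝ := fun l => Matrix.of fun i j => (S l i j : ℝ) with hSR
  let τ : Fin (n + 1) → ℝ := fun j => (a j : ℝ) / (b j : ℝ)
  have hbR : ∀ j, (0 : ℝ) < b j := fun j => by exact_mod_cast hb j
  have hτpos : ∀ j, 0 < τ j := fun j => div_pos (by exact_mod_cast ha j) (hbR j)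
  have hτ : StrictMono τ := by
    refine Fin.strictMono_iff_lt_succ.mpr (fun i => ?_)
    show (a i.castSucc : ℝ) / b i.castSucc < (a i.succ : ℝ) / b i.succ
    rw [div_lt_div_iff₀ (hbR _) (hbR _)]
    exact_mod_cast hlt i
  -- the degree budget from the potentials
  have hdeg : (pencil d SR).det.natDegree ≤ n := by
    rw [← hsum]
    refine natDegree_det_le_of_potentials (pencil d SR) r c fun i j => ?_
    refine natDegree_pencil_entry_le d SR i j _ fun l hl => hpot l i j ?_
    simpa [hSR] using hl
  refine fullyRealisable_of_certificate d SR (fun l => realLetters_isSymm hS l) (pencil d SR).det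
    (fun t => (eval_det_pencil SR d t).symm) hdeg τ hτ hτpos (fun i => ?_)
  -- alternation at consecutive points from the integer signs
  have hD : ∀ l, d l ≤ finMax K d := le_finMax d
  have key : ∀ j : Fin (n + 1),
      ((b j : ℝ) ^ finMax K d) ^ m * (∑ l, τ j ^ d l • SR l).det
        = (idet m (evalAt m K (finMax K d) d S (a j) (b j)) : ℝ) := fun j =>
    det_evalAt d hD S (a j) (b j) (ne_of_gt (hbR j))
  have hc : ∀ j : Fin (n + 1), (0 : ℝ) < ((b j : ℝ) ^ finMax K d) ^ m := fun j =>
    pow_pos (pow_pos (hbR j) _) _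
  have hneg := mul_neg_of_sign (hsg i)
  rw [← key, ← key] at hneg
  have hcc : (0 : ℝ) < ((b i.castSucc : ℝ) ^ finMax K d) ^ m * ((b i.succ : ℝ) ^ finMax K d) ^ m :=
    mul_pos (hc _) (hc _)
  have hprod : ((b i.castSucc : ℝ) ^ finMax K d) ^ m * ((b i.succ : ℝ) ^ finMax K d) ^ m
      * ((∑ l, τ i.castSucc ^ d l • SR l).det * (∑ l, τ i.succ ^ d l • SR l).det) < 0 := by
    calc ((b i.castSucc : ℝ) ^ finMax K d) ^ m * ((b i.succ : ℝ) ^ finMax K d) ^ m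
          * ((∑ l, τ i.castSucc ^ d l • SR l).det * (∑ l, τ i.succ ^ d l • SR l).det)
        = (((b i.castSucc : ℝ) ^ finMax K d) ^ m * (∑ l, τ i.castSucc ^ d l • SR l).det)
          * ((((b i.succ : ℝ) ^ finMax K d) ^ m) * (∑ l, τ i.succ ^ d l • SR l).det) := by ring
      _ < 0 := hneg
  exact lt_of_not_ge (fun hge => absurd hprod (not_lt.mpr (mul_nonneg hcc.le hge)))

/-! ### Smoke test: the kit's toy pencil `diag(−1,−2) + t·1`, `det = (t−1)(t−2)`: `FullyRealisable 2 ![0,1] 2`. -/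

/-- Toy instance (an `example`): the `2 × 2` two-letter pencil `diag(−1,−2) + t·1` realises degree `2` with two positive
roots; potentials `r = (0,0)`, `c = (1,1)`. [folklore] -/
example : FullyRealisable 2 (![0, 1] : Fin 2 → ℕ) 2 :=
  fullyRealisable_of_certCheckG (S := ![![![-1, 0], ![0, -2]], ![![1, 0], ![0, 1]]]) (a := ![1, 3, 4]) (b := ![2, 2, 1])
    (by decide +kernel) ![0, 0] ![1, 1] (by decide) (by decide)

end Summit.ValiantsHypothesis.ValiantsHypothesis.Theorems.LacunarySymmetroidMatrixDescartes.FiniteSector
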